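import Summits.QuantumFields.BalabanUV.T4Continuum.Support.NE7K1LinBlochDenominator

/-!
# NE7K1LinBlochDenominatorFat — row NE7 (node U5), candidate route HOM, path H1L, cell K1-lin(s): NEEDS-ESTIMATE #E1, B-E1 TYPED —
# THEOREM S ON A FATTENED STRIP: the Bloch denominator `𝓝_L` has no zero on `|Re p_μ| ≤ π + r(d)∕2`, `|Im p_μ| ≤ κ_F(d)` (constants in
# `d` alone, every `L ≥ 1`), so the block-mean multiplier `k_L = Δ^ξ_L ∕ 𝓝_L` is holomorphic and bounded on a complex
# NEIGHBOURHOOD of the closed Brillouin zone — the shape Cauchy estimates (derivative bounds, clause (e′)) and the off-axis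
# real-part floor (clauses (a′)(b′), file 51) consume

Lineage `b2b-balaban-t4-ne7-p2` (CRUX PROVER NE7 #2), generation 74; file 50.  File 47's THEOREM S bounds `𝓝_L` below on
`B4Strip.Strip d κ_N(d)` (`|Re p_μ| ≤ π`), which is what the contour shift itself needs (file 48: `StripRegular (kL L)`).  Every
DERIVATIVE bound of `k_L` (S-64-1 §3 (e′) «C² bounds», and the quadratic off-axis floor (a′)(b′)) is a Cauchy estimate on a complex
disc around a strip point, and such a disc sticks out of `|Re p_μ| ≤ π` in the REAL direction; b04's engine handles this for
`Δ^ξ` by working on the FAT region `B4StripCauchy.Fat d r` (`|Re q_ν| ≤ π + r`).  THIS FILE supplies the same for `𝓝_L` and `k_L`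
by a TRANSLATION TRICK over b04's abstract lemmas ([folklore]):

* §1 THE REAL FLOOR ON THE FATTENED ZONE: `uFactorr_zero_ge_fat : 1∕4 ≤ |u_L(x)|²`-factor for `|x| ≤ π + 1∕4` (Jordan on `|x| ≤ π`;
  `sin(x∕2) = cos(x∕2 − π∕2) ≥ 1 − 1∕128` beyond), `Ur_zero_ge_fat`, `Nsymr_ge_fat : (1∕4)^d ≤ 𝓝_L(s)` for `|s_μ| ≤ π + 1∕4`.
* §2 THE TRANSLATED DENOMINATOR `p ↦ 𝓝_L(p + c)`, `c` real with `|c_μ| ≤ r(d)∕2`: slice-holomorphic and bounded by `M_N(d)` on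
  `Fat d (r(d)∕2)` (file 47 §3–§4 at the translated point), real floor `(1∕4)^d` on the zone (§1) ⇒ `B4Strip.strip_lower_bound` +
  `B4StripCauchy.imLipschitz_of_fat`: `c_F(d) := (1∕4)^d∕2 ≤ ‖𝓝_L(p + c)‖` on `Strip d κ_F(d)`, `κ_F(d) := min(r(d)∕2, c_F∕(Λ_F·d+1))`,
  `Λ_F(d) = 2M_N(d)∕r(d)` (`Nsym_transl_strip_lower`).
* §3 **THEOREM S′** `Nsym_fstrip_lower`: for EVERY `L ≥ 1` and every `p` with `|Re p_μ| ≤ π + r(d)∕2`, `|Im p_μ| ≤ κ_F(d)`: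
  `c_F(d) ≤ ‖𝓝_L(p)‖` (clamp the real parts into `[−π, π]`, the remainder is a real translation `c` with `|c_μ| ≤ r(d)∕2`).
* §4 `k_L` ON THE FATTENED STRIP `FStrip d (r(d)∕2) κ_F(d)`: joint holomorphy `differentiableAt_kL_fstrip`, the bound
  `norm_kL_le_fstrip : ‖k_L‖ ≤ 16d ∕ c_F(d)`, and the FIRST-DERIVATIVE BOUND IN EVERY COORDINATE (clause (e′), Cauchy's estimate BY
  NAME — `B4StripCauchy.norm_deriv_slice_le`): `norm_deriv_kL_slice_le : ‖∂_μ k_L(q)‖ ≤ (16d∕c_F(d)) ∕ (κ_F(d)∕2)` on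
  `Strip d κ`, `κ ≤ κ_F(d)∕2`, every `L ≥ 1`.

HONEST FRAMING: [folklore]; the only new estimate is the one-variable floor of §1, everything else is file 47 and b04's abstract
lemmas BY NAME at translated points; constants existence-grade and `d`-only; higher derivatives follow the same way (not typed);
the off-axis floor is file 51; R-E1 untouched; nothing of Bałaban's asserted; no `sorry`.  Census only; NE7 NOT PRINTED ∕ NOT
PROVED; spine 0∕9; FIXED FINITE T⁴, rung (B)+1; NOT infinite volume, NOT mass gap, NOT Clay.  HONEST DEPENDENCY: continuum YM on
T⁴ ⇐ BetaPertH ∧ nine spine estimates (0/9 proved); BetaPertH ⇐ (D1) ∧ (D4) ∧ CAP+tail; G-an2-4 gates asym, D1 and NE2/3/4.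
-/

noncomputable section

open Finset Complex Set

namespace Summit.QuantumFields.BalabanUV.T4Continuum.NE7K1LinBlochDenominatorFat

open Literature.MathematicalPhysics.QuantumFieldTheory.Balaban1983to89
open Literature.MathematicalPhysics.QuantumFieldTheory.Balaban1983to89.B4Strip
open Literature.MathematicalPhysics.QuantumFieldTheory.Balaban1983to89.B4StripCauchy
open Literature.MathematicalPhysics.QuantumFieldTheory.Balaban1983to89.B5Strip145Analytic
open NE7K1LinBlochDenominator

variable {d : ℕ}

/-! ### §1 The real floor on the fattened zone `|x| ≤ π + 1∕4` -/

/-- beyond the zone edge: for `π ≤ x ≤ π + 1∕4`, `x ≤ 4·sin(x∕2)` (`sin(x∕2) = cos(x∕2 − π∕2) ≥ 1 − (1∕8)²∕2`). [folklore] -/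
theorem le_four_mul_sin_half {x : ℝ} (h1 : Real.pi ≤ x) (h2 : x ≤ Real.pi + 1 / 4) : x ≤ 4 * Real.sin (x / 2) := by
  have hπ := Real.pi_lt_d2
  have hπ3 := Real.pi_gt_three
  have e : Real.sin (x / 2) = Real.cos (x / 2 - Real.pi / 2) := by rw [Real.cos_sub_pi_div_two]
  have ht0 : 0 ≤ x / 2 - Real.pi / 2 := by linarith
  have ht1 : x / 2 - Real.pi / 2 ≤ 1 / 8 := by linarith
  have hcos : 1 - (x / 2 - Real.pi / 2) ^ 2 / 2 ≤ Real.cos (x / 2 - Real.pi / 2) := Real.one_sub_sq_div_two_le_cos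
  have hsq : (x / 2 - Real.pi / 2) ^ 2 ≤ (1 / 8) ^ 2 := pow_le_pow_left₀ ht0 ht1 2
  rw [e]
  nlinarith

/-- **THE FILLED FACTOR ON THE FATTENED ZONE**: `1∕4 ≤ ρ_L(x) = |u_L|²`-factor at residue `0` for `|x| ≤ π + 1∕4`, every `L ≥ 1`
(on `|x| ≤ π` the tree's `4∕π² ≥ 1∕4`; beyond, `S_ξ(x) ≤ x² ≤ 16 sin²(x∕2) = 4·S₁(x)`). [folklore] -/
theorem uFactorr_zero_ge_fat (n : ℕ) (hn : 1 ≤ n) (x : ℝ) (hx : |x| ≤ Real.pi + 1 / 4) : 1 / 4 ≤ uFactorr n 0 x := by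
  have hπ3 := Real.pi_gt_three
  by_cases hz : |x| ≤ Real.pi
  · have hπ2 : Real.pi ^ 2 < 16 := by nlinarith [Real.pi_lt_d2, Real.pi_pos.le]
    have h14 : (1 : ℝ) / 4 ≤ 4 / Real.pi ^ 2 := by
      rw [div_le_div_iff₀ (by norm_num) (by positivity)]; nlinarith
    exact h14.trans (uFactorr_zero_ge n hn x hz)
  rw [not_le] at hz
  have hx0 : x ≠ 0 := by intro h; rw [h, abs_zero] at hz; linarith
  -- reduce to |x| by evenness of the two symbols
  have key : ∀ y : ℝ, Real.pi < y → y ≤ Real.pi + 1 / 4 → 1 / 4 ≤ S1r y / Sxir n y := by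
    intro y hy1 hy2
    have hy0 : 0 < y := by linarith
    have hS : Sxir n y ≤ y ^ 2 := Sxir_le n y
    have hsin := le_four_mul_sin_half hy1.le hy2
    have hS1 : y ^ 2 ≤ 4 * S1r y := by
      rw [S1r_eq]
      nlinarith
    rcases (Sxir_nonneg n y).eq_or_lt with h0 | hpos
    · -- `S_ξ(y) = 0` is impossible here, but the junk value also satisfies the bound: `S₁∕0 = 0`?  No — exclude it.
      exfalso
      rw [Sxir_eq] at h0
      have hn0 : (0 : ℝ) < n := by exact_mod_cast (show 0 < n by omega)
      have hs0 : Real.sin (y / (2 * n)) = 0 := by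
        have : 4 * (n : ℝ) ^ 2 * Real.sin (y / (2 * n)) ^ 2 = 0 := h0.symm
        have h4 : (4 : ℝ) * (n : ℝ) ^ 2 ≠ 0 := by positivity
        exact pow_eq_zero_iff (n := 2) (by norm_num) |>.mp ((mul_eq_zero.mp this).resolve_left h4)
      rw [Real.sin_eq_zero_iff_of_lt_of_lt] at hs0
      · have : y = 0 := by
          have h2n : (0 : ℝ) < 2 * n := by positivity
          field_simp at hs0
          linarith [hs0]
        linarith
      · have : 0 < y / (2 * n) := by positivity
        linarith
      · rw [div_lt_iff₀ (by positivity)]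
        have h1n : (1 : ℝ) ≤ n := by exact_mod_cast hn
        nlinarith [Real.pi_lt_d2]
    · rw [le_div_iff₀ hpos]
      nlinarith
  have hu : uFactorr n 0 x = S1r x / Sxir n x := by simp [uFactorr, hx0]
  rw [hu]
  rcases le_or_gt 0 x with hx1 | hx1
  · rw [abs_of_nonneg hx1] at hz hx
    exact key x hz hx
  · rw [abs_of_neg hx1] at hz hx
    have e1 : S1r x = S1r (-x) := by simp [S1r, Real.cos_neg]
    have e2 : Sxir n x = Sxir n (-x) := by simp [Sxir, neg_div, Real.cos_neg]
    rw [e1, e2]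
    exact key (-x) hz hx

/-- `(1∕4)^d ≤ |u_L(s)|²` on the fattened zone `|s_μ| ≤ π + 1∕4`. [folklore] -/
theorem Ur_zero_ge_fat (n : ℕ) [NeZero n] (hn : 1 ≤ n) (s : Fin d → ℝ) (hs : ∀ μ, |s μ| ≤ Real.pi + 1 / 4) :
    (1 / 4 : ℝ) ^ d ≤ Ur n (fun _ => (0 : Fin n)) s := by
  unfold Ur
  have : (1 / 4 : ℝ) ^ d = ∏ _μ : Fin d, (1 / 4 : ℝ) := by
    rw [Finset.prod_const, Finset.card_univ, Fintype.card_fin]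
  rw [this]
  apply Finset.prod_le_prod
  · intro μ _; positivity
  · intro μ _; simpa using uFactorr_zero_ge_fat n hn (s μ) (hs μ)

/-- REAL FLOOR ON THE FATTENED ZONE: `(1∕4)^d ≤ 𝓝_L(s)` for `|s_μ| ≤ π + 1∕4`, every `L ≥ 1`. [folklore] -/
theorem Nsymr_ge_fat (L : ℕ) [NeZero L] (hL : 1 ≤ L) (s : Fin d → ℝ) (hs : ∀ μ, |s μ| ≤ Real.pi + 1 / 4) :
    (1 / 4 : ℝ) ^ d ≤ Nsymr L s := by
  unfold Nsymr
  have h1 := DeltaXir_nonneg L 0 le_rfl s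
  have h2 := Ur_zero_ge_fat L hL s hs
  have h3 : 0 ≤ ∑ k ∈ (Finset.univ.erase (fun _ => (0 : Fin L))),
        Ur L k s * (DeltaXir L 0 s / DeltaXir L 0 (shiftr L k s)) := by
    apply Finset.sum_nonneg; intro k _
    exact mul_nonneg (Ur_nonneg _ _ _) (div_nonneg h1 (DeltaXir_nonneg L 0 le_rfl _))
  linarith

/-! ### §2 The translated denominator and its strip bound -/

/-- the real embedding is additive. [folklore] -/
theorem ofRealVec_add (s c : Fin d → ℝ) : ofRealVec (s + c) = ofRealVec s + ofRealVec c := by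
  funext μ; simp [ofRealVec]

/-- a point of `Fat d (r∕2)` translated by a real vector `|c_μ| ≤ r∕2` lies in `Fat d r`. [folklore] -/
theorem add_mem_fat {r : ℝ} {q : Fin d → ℂ} (hq : q ∈ Fat d (r / 2)) {c : Fin d → ℝ} (hc : ∀ μ, |c μ| ≤ r / 2) :
    q + ofRealVec c ∈ Fat d r := by
  intro ν
  obtain ⟨h1, h2⟩ := hq ν
  have h3 := hc ν
  have h4 := abs_nonneg ((q ν).im)
  simp only [Pi.add_apply, ofRealVec, add_re, ofReal_re, add_im, ofReal_im, add_zero]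
  exact ⟨(abs_add_le _ _).trans (by linarith), by linarith⟩

/-- the fattened-strip floor `c_F(d) = (1∕4)^d ∕ 2`. [folklore] -/
def cF (d : ℕ) : ℝ := (1 / 4 : ℝ) ^ d / 2

/-- `c_F(d) > 0`. [folklore] -/
theorem cF_pos (d : ℕ) : 0 < cF d := by unfold cF; positivity

/-- the imaginary-direction Lipschitz constant on the half-radius fat region, `Λ_F(d) = M_N(d) ∕ (r(d)∕2)`. [folklore] -/
def LamF (d : ℕ) : ℝ := MN d / (rOf d / 2)

/-- `Λ_F(d) ≥ 0`. [folklore] -/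
theorem LamF_nonneg (d : ℕ) : 0 ≤ LamF d := div_nonneg (MN_pos d).le (by have := rOf_pos d; positivity)

/-- THE FATTENED-STRIP HALF-WIDTH `κ_F(d) = min (r(d)∕2, c_F(d) ∕ (Λ_F(d)·d + 1))`, explicit in `d` alone. [folklore] -/
def kappaF (d : ℕ) : ℝ := min (rOf d / 2) (cF d / (LamF d * d + 1))

/-- `κ_F(d) > 0`. [folklore] -/
theorem kappaF_pos (d : ℕ) : 0 < kappaF d := by
  unfold kappaF
  have := LamF_nonneg d
  exact lt_min (by have := rOf_pos d; positivity) (div_pos (cF_pos d) (by positivity))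

/-- `κ_F(d) ≤ r(d)∕2`. [folklore] -/
theorem kappaF_le (d : ℕ) : kappaF d ≤ rOf d / 2 := min_le_left _ _

/-- `κ_F(d) ≤ 1∕8`. [folklore] -/
theorem kappaF_le_eighth (d : ℕ) : kappaF d ≤ 1 / 8 := by
  have := rOf_le d; have := kappaF_le d; linarith

/-- the smallness `Λ_F(d)·(d·κ_F(d)) ≤ c_F(d)` built into `κ_F`. [folklore] -/
theorem LamF_mul_le (d : ℕ) : LamF d * (d * kappaF d) ≤ cF d := by
  have hΛ := LamF_nonneg d
  have hden : 0 < LamF d * d + 1 := by positivity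
  have h1 : kappaF d ≤ cF d / (LamF d * d + 1) := min_le_right _ _
  have h2 : LamF d * d * kappaF d ≤ LamF d * d * (cF d / (LamF d * d + 1)) :=
    mul_le_mul_of_nonneg_left h1 (by positivity)
  have h3 : LamF d * d * (cF d / (LamF d * d + 1)) ≤ cF d := by
    rw [mul_div_assoc', div_le_iff₀ hden]
    nlinarith [cF_pos d]
  calc LamF d * (d * kappaF d) = LamF d * d * kappaF d := by ring
    _ ≤ cF d := h2.trans h3

/-- THE TRANSLATED DENOMINATOR IS BOUNDED BELOW ON THE STRIP: for a real translation `|c_μ| ≤ r(d)∕2`, every `L ≥ 1` and every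
`p ∈ Strip d κ_F(d)`: `c_F(d) ≤ ‖𝓝_L(p + c)‖` — `B4Strip.strip_lower_bound` for `g = 𝓝_L(· + c)` with the floor of §1 (the translated
real point lies in the fattened zone), slice-holomorphy and the bound `M_N` of file 47 on `Fat d r(d)` at the translated point, and
`B4StripCauchy.imLipschitz_of_fat` on `Fat d (r(d)∕2)`. [folklore] -/
theorem Nsym_transl_strip_lower (L : ℕ) [NeZero L] {c : Fin d → ℝ} (hc : ∀ μ, |c μ| ≤ rOf d / 2) :
    ∀ p ∈ Strip d (kappaF d), cF d ≤ ‖Nsym L (p + ofRealVec c)‖ := by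
  have hL : 1 ≤ L := Nat.one_le_iff_ne_zero.mpr (NeZero.ne L)
  have hr := rOf_pos d
  have hr4 := rOf_le d
  have hdiff : ∀ q ∈ Fat d (rOf d / 2), ∀ μ,
      DifferentiableAt ℂ (fun w => Nsym L (Function.update q μ w + ofRealVec c)) (q μ) := by
    intro q hq μ
    have hg := differentiableAt_Nsym L (rOf_le d) (d_mul_rOf_sq_le d) (add_mem_fat hq hc)
    have e : Function.update q μ (q μ) + ofRealVec c = q + ofRealVec c := by rw [Function.update_eq_self]
    rw [← e] at hg
    exact hg.comp (q μ) ((differentiableAt_update q μ (q μ)).add_const _)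
  have hbound : ∀ q ∈ Fat d (rOf d / 2), ‖Nsym L (q + ofRealVec c)‖ ≤ MN d :=
    fun q hq => norm_Nsym_le L (rOf_le d) (d_mul_rOf_sq_le d) (add_mem_fat hq hc)
  apply strip_lower_bound (fun p => Nsym L (p + ofRealVec c)) (cF d) (LamF d) (kappaF d) _ _ (LamF_nonneg d)
    (LamF_mul_le d)
  · intro s hs
    have hsc : ∀ μ, |(s + c) μ| ≤ Real.pi + 1 / 4 := fun μ =>
      (abs_add_le (s μ) (c μ)).trans (by linarith [hs μ, hc μ])
    show 2 * cF d ≤ ‖Nsym L (ofRealVec s + ofRealVec c)‖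
    rw [← ofRealVec_add, Nsym_ofReal, Complex.norm_real]
    have := Nsymr_ge_fat L hL (s + c) hsc
    unfold cF
    exact le_trans (by linarith) (this.trans (le_abs_self _))
  · have h := imLipschitz_of_fat (fun p => Nsym L (p + ofRealVec c)) (r := rOf d / 2) (by positivity)
      (kappaF_pos d).le (kappaF_le d) hdiff hbound
    unfold LamF
    exact h

/-! ### §3 THEOREM S′: the zero-free fattened strip -/

/-- the fattened strip: `|Re p_μ| ≤ π + ρ`, `|Im p_μ| ≤ κ`. [folklore] -/
def FStrip (d : ℕ) (ρ κ : ℝ) : Set (Fin d → ℂ) := {p | ∀ μ, |(p μ).re| ≤ Real.pi + ρ ∧ |(p μ).im| ≤ κ}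

/-- clamping a real number within `ρ` of `[−π, π]` into `[−π, π]` moves it by at most `ρ`. [folklore] -/
theorem clamp_props {x ρ : ℝ} (hρ : 0 ≤ ρ) (hx : |x| ≤ Real.pi + ρ) :
    |max (-Real.pi) (min Real.pi x)| ≤ Real.pi ∧ |x - max (-Real.pi) (min Real.pi x)| ≤ ρ := by
  have hπ := Real.pi_pos
  obtain ⟨hx1, hx2⟩ := abs_le.mp hx
  rcases le_total x Real.pi with h1 | h1
  · rw [min_eq_right h1]
    rcases le_total (-Real.pi) x with h2 | h2
    · rw [max_eq_right h2, sub_self, abs_zero]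
      exact ⟨abs_le.mpr ⟨h2, h1⟩, by linarith⟩
    · rw [max_eq_left h2, abs_neg, abs_of_pos hπ]
      exact ⟨le_rfl, abs_le.mpr ⟨by linarith, by linarith⟩⟩
  · rw [min_eq_left h1, max_eq_right (by linarith), abs_of_pos hπ]
    exact ⟨le_rfl, abs_le.mpr ⟨by linarith, by linarith⟩⟩

/-- **THEOREM S′ (THE ZERO-FREE FATTENED STRIP).**  For every `d`, EVERY `L ≥ 1` and every complex momentum `p` with
`|Re p_μ| ≤ π + r(d)∕2` and `|Im p_μ| ≤ κ_F(d)`:  `c_F(d) = (1∕4)^d∕2 ≤ ‖𝓝_L(p)‖` — constants in `d` ALONE.  (Clamp `Re p` into the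
zone; the remainder is a real translation of size `≤ r(d)∕2`; apply §2.) [folklore] -/
theorem Nsym_fstrip_lower (L : ℕ) [NeZero L] {p : Fin d → ℂ} (hp : p ∈ FStrip d (rOf d / 2) (kappaF d)) :
    cF d ≤ ‖Nsym L p‖ := by
  set c : Fin d → ℝ := fun μ => (p μ).re - max (-Real.pi) (min Real.pi (p μ).re) with hcdef
  have hρ : 0 ≤ rOf d / 2 := by have := rOf_pos d; positivity
  have hc : ∀ μ, |c μ| ≤ rOf d / 2 := fun μ => (clamp_props hρ (hp μ).1).2
  have hp0 : p - ofRealVec c ∈ Strip d (kappaF d) := by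
    intro μ
    simp only [Pi.sub_apply, ofRealVec, sub_re, ofReal_re, sub_im, ofReal_im, sub_zero, hcdef, sub_sub_cancel]
    exact ⟨(clamp_props hρ (hp μ).1).1, (hp μ).2⟩
  have h := Nsym_transl_strip_lower L hc (p - ofRealVec c) hp0
  rwa [sub_add_cancel] at h

/-- `𝓝_L ≠ 0` on the fattened strip. [folklore] -/
theorem Nsym_ne_zero_fstrip (L : ℕ) [NeZero L] {p : Fin d → ℂ} (hp : p ∈ FStrip d (rOf d / 2) (kappaF d)) :
    Nsym L p ≠ 0 := fun h => by
  have := Nsym_fstrip_lower L hp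
  rw [h, norm_zero] at this
  exact absurd this (not_le.mpr (cF_pos d))

/-- the fattened strip lies in b04's fat region `Fat d r(d)`. [folklore] -/
theorem fstrip_subset_fat : FStrip d (rOf d / 2) (kappaF d) ⊆ Fat d (rOf d) := by
  intro p hp ν
  have h1 := (hp ν).1; have h2 := (hp ν).2
  have := kappaF_le d; have := rOf_pos d
  exact ⟨by linarith, by linarith⟩

/-- the strip of half-width `κ_F(d)` lies in the fattened strip. [folklore] -/
theorem strip_subset_fstrip : Strip d (kappaF d) ⊆ FStrip d (rOf d / 2) (kappaF d) := by
  intro p hp ν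
  have := rOf_pos d
  exact ⟨(hp ν).1.trans (by linarith), (hp ν).2⟩

/-! ### §4 `k_L` on the fattened strip: holomorphy, bound, first-derivative bound -/

/-- `k_L` is holomorphic (jointly) at every point of the fattened strip, every `L ≥ 1`. [folklore] -/
theorem differentiableAt_kL_fstrip (L : ℕ) [NeZero L] {p : Fin d → ℂ} (hp : p ∈ FStrip d (rOf d / 2) (kappaF d)) :
    DifferentiableAt ℂ (kL L) p := by
  show DifferentiableAt ℂ (fun q => kL L q) p
  simp only [kL]
  exact dAt_div (differentiableAt_DeltaXi L 0 p)
    (differentiableAt_Nsym L (rOf_le d) (d_mul_rOf_sq_le d) (fstrip_subset_fat hp)) (Nsym_ne_zero_fstrip L hp)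

/-- `‖k_L(p)‖ ≤ 16d ∕ c_F(d)` on the fattened strip, every `L ≥ 1`. [folklore] -/
theorem norm_kL_le_fstrip (L : ℕ) [NeZero L] {p : Fin d → ℂ} (hp : p ∈ FStrip d (rOf d / 2) (kappaF d)) :
    ‖kL L p‖ ≤ 16 * d / cF d := by
  have hL : 1 ≤ L := Nat.one_le_iff_ne_zero.mpr (NeZero.ne L)
  unfold kL
  rw [norm_div]
  have hD : ‖DeltaXi L 0 p‖ ≤ 16 * d := by
    have := norm_DeltaXi_le L hL 0 le_rfl (rOf_le d) (fstrip_subset_fat hp); linarith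
  calc ‖DeltaXi L 0 p‖ / ‖Nsym L p‖ ≤ ‖DeltaXi L 0 p‖ / cF d :=
        div_le_div_of_nonneg_left (norm_nonneg _) (cF_pos d) (Nsym_fstrip_lower L hp)
    _ ≤ 16 * d / cF d := div_le_div_of_nonneg_right hD (cF_pos d).le

/-- b04's fat region of radius `κ_F(d)∕2` lies in the fattened strip (so its coordinate discs carry Cauchy estimates). [folklore] -/
theorem fat_half_kappaF_subset : Fat d (kappaF d / 2) ⊆ FStrip d (rOf d / 2) (kappaF d) := by
  intro p hp ν
  obtain ⟨h1, h2⟩ := hp ν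
  have := kappaF_le d; have := (kappaF_pos d).le
  exact ⟨by linarith, by linarith⟩

/-- **FIRST-DERIVATIVE BOUND IN EVERY COORDINATE (clause (e′), Cauchy's estimate BY NAME).**  For `0 ≤ κ ≤ κ_F(d)∕2`, every `L ≥ 1`,
every `q ∈ Strip d κ` and every coordinate `μ`:  `‖∂_μ k_L(q)‖ ≤ (16d ∕ c_F(d)) ∕ (κ_F(d)∕2)` (`B4StripCauchy.norm_deriv_slice_le` with
the data of this section on `Fat d (κ_F∕2)`). [folklore] -/
theorem norm_deriv_kL_slice_le (L : ℕ) [NeZero L] {κ : ℝ} (hκ : κ ≤ kappaF d / 2) {q : Fin d → ℂ} (hq : q ∈ Strip d κ)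
    (μ : Fin d) : ‖deriv (fun w => kL L (Function.update q μ w)) (q μ)‖ ≤ (16 * d / cF d) / (kappaF d / 2) := by
  have hdiff : ∀ q ∈ Fat d (kappaF d / 2), ∀ μ, DifferentiableAt ℂ (fun w => kL L (Function.update q μ w)) (q μ) := by
    intro q hq μ
    have h := differentiableAt_kL_fstrip L (fat_half_kappaF_subset hq)
    rw [← Function.update_eq_self μ q] at h
    exact h.comp (q μ) (differentiableAt_update q μ (q μ))
  have hbound : ∀ q ∈ Fat d (kappaF d / 2), ‖kL L q‖ ≤ 16 * d / cF d :=
    fun q hq => norm_kL_le_fstrip L (fat_half_kappaF_subset hq)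
  exact norm_deriv_slice_le (kL L) (half_pos (kappaF_pos d)) hκ hdiff hbound hq μ

end Summit.QuantumFields.BalabanUV.T4Continuum.NE7K1LinBlochDenominatorFat

end
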